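import Summits.CriticalPhenomena.Ising3DConformalLimit.Theorems.SynchronousCouplingDefs

/-!
# Route `SynchronousCoupling`, crux `RotationJoining` (stmt-CriticalPhenomena-18763), line `SketchIdeator2`:
gluing couplings in `L²` (tool for `stub_rateBootstrap`)

Pure measure theory, no lattice input. For couplings `P` of `(μ₁, μ₂)` and `Q` of `(μ₂, μ₃)` on a standard Borel
space there is a coupling `T` of `(μ₁, μ₃)` under which, for ALL bounded measurable observables `F, G, H` at once,
`‖F∘fst − H∘snd‖_{L²(T)} ≤ ‖F∘fst − G∘snd‖_{L²(P)} + ‖G∘fst − H∘snd‖_{L²(Q)}` (gluing lemma, Villani 2009 Ch. 1, via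
Mathlib's disintegration `Measure.condKernel` exactly as in
`Literature.Probability.RandomPlanarGeometry.exists_glued_coupling`, plus Minkowski in `L²` of the glued triple
space, proved here by the elementary `(x+y)² ≤ (1+t)x² + (1+1/t)y²`). Iterating along a finite chain of couplings
of one probability measure `μ` with itself gives `l2_glue_chain`: one coupling `T` of `μ` with `μ` with
`‖F₀∘fst − F_L∘snd‖_{L²(T)} ≤ Σ_{k<L} ‖F_k∘fst − F_{k+1}∘snd‖_{L²(π_k)}` for every family `(F_k)` simultaneously — the
window-uniformity of the crux's couplings is thereby automatic. `stub_l2GlueChain` is the registered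
specialisation to `SpinConfig (Site 3)` (standard Borel by instance inference: countable product of the discrete `ℤˣ`).
-/

noncomputable section

namespace Summit.CriticalPhenomena.Ising3DConformalLimit.Cruxes.RotationJoining.RateSplitting

open MeasureTheory ProbabilityTheory

/-! ### Elementary `L²` triangle inequality for bounded measurable real functions -/

section Elementary

variable {α : Type*} [MeasurableSpace α]

/-- A bounded measurable real function on a finite measure space is integrable. -/
theorem integrable_of_measurable_of_abs_le (μ : Measure α) [IsFiniteMeasure μ] {f : α → ℝ}
    (hf : Measurable f) {B : ℝ} (hB : ∀ x, |f x| ≤ B) : Integrable f μ :=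
  Integrable.of_bound hf.aestronglyMeasurable B (ae_of_all _ fun x => by
    rw [Real.norm_eq_abs]; exact hB x)

/-- The square of a difference of bounded measurable functions is integrable (finite measure). -/
theorem integrable_sq_sub (μ : Measure α) [IsFiniteMeasure μ] {f g : α → ℝ} (hf : Measurable f)
    (hg : Measurable g) {B C : ℝ} (hB : ∀ x, |f x| ≤ B) (hC : ∀ x, |g x| ≤ C) :
    Integrable (fun x => (f x - g x) ^ 2) μ := by
  refine integrable_of_measurable_of_abs_le μ ((hf.sub hg).pow_const 2) (B := (B + C) ^ 2) fun x => ?_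
  rw [abs_pow]
  refine pow_le_pow_left₀ (abs_nonneg _) ?_ 2
  calc |f x - g x| ≤ |f x| + |g x| := abs_sub _ _
    _ ≤ B + C := add_le_add (hB x) (hC x)

/-- The pointwise inequality behind Minkowski in `L²`: `(x + y)² ≤ (1 + t) x² + (1 + t⁻¹) y²` for `t > 0`. -/
theorem add_sq_le_weighted {t : ℝ} (ht : 0 < t) (x y : ℝ) :
    (x + y) ^ 2 ≤ (1 + t) * x ^ 2 + (1 + t⁻¹) * y ^ 2 := by
  have key : t * ((1 + t) * x ^ 2 + (1 + t⁻¹) * y ^ 2 - (x + y) ^ 2) = (t * x - y) ^ 2 := by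
    field_simp
    ring
  have h0 : 0 ≤ (1 + t) * x ^ 2 + (1 + t⁻¹) * y ^ 2 - (x + y) ^ 2 := by
    have := sq_nonneg (t * x - y)
    rw [← key] at this
    exact (mul_nonneg_iff_of_pos_left ht).mp this
  linarith

/-- **Minkowski in `L²` for bounded measurable real functions** (finite measure), in the form
`√∫(a−c)² ≤ √∫(a−b)² + √∫(b−c)²`. -/
theorem sqrt_integral_sq_sub_le (μ : Measure α) [IsFiniteMeasure μ] {a b c : α → ℝ}
    (ha : Measurable a) (hb : Measurable b) (hc : Measurable c)
    (hab : ∃ B, ∀ x, |a x| ≤ B) (hbb : ∃ B, ∀ x, |b x| ≤ B) (hcb : ∃ B, ∀ x, |c x| ≤ B) :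
    Real.sqrt (∫ x, (a x - c x) ^ 2 ∂μ) ≤
      Real.sqrt (∫ x, (a x - b x) ^ 2 ∂μ) + Real.sqrt (∫ x, (b x - c x) ^ 2 ∂μ) := by
  obtain ⟨Ba, hBa⟩ := hab
  obtain ⟨Bb, hBb⟩ := hbb
  obtain ⟨Bc, hBc⟩ := hcb
  set X := ∫ x, (a x - b x) ^ 2 ∂μ with hX
  set Y := ∫ x, (b x - c x) ^ 2 ∂μ with hY
  set Z := ∫ x, (a x - c x) ^ 2 ∂μ with hZ
  have hX0 : 0 ≤ X := integral_nonneg fun x => sq_nonneg _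
  have hY0 : 0 ≤ Y := integral_nonneg fun x => sq_nonneg _
  have hIab : Integrable (fun x => (a x - b x) ^ 2) μ := integrable_sq_sub μ ha hb hBa hBb
  have hIbc : Integrable (fun x => (b x - c x) ^ 2) μ := integrable_sq_sub μ hb hc hBb hBc
  have hIac : Integrable (fun x => (a x - c x) ^ 2) μ := integrable_sq_sub μ ha hc hBa hBc
  -- for every `t > 0`, `Z ≤ (1+t) X + (1+t⁻¹) Y`
  have hZt : ∀ t : ℝ, 0 < t → Z ≤ (1 + t) * X + (1 + t⁻¹) * Y := by
    intro t ht
    have hle : ∀ x, (a x - c x) ^ 2 ≤ (1 + t) * (a x - b x) ^ 2 + (1 + t⁻¹) * (b x - c x) ^ 2 := by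
      intro x
      have := add_sq_le_weighted ht (a x - b x) (b x - c x)
      rwa [show a x - b x + (b x - c x) = a x - c x by ring] at this
    calc Z ≤ ∫ x, ((1 + t) * (a x - b x) ^ 2 + (1 + t⁻¹) * (b x - c x) ^ 2) ∂μ :=
          integral_mono hIac ((hIab.const_mul _).add (hIbc.const_mul _)) hle
      _ = (1 + t) * X + (1 + t⁻¹) * Y := by
          rw [integral_add (hIab.const_mul _) (hIbc.const_mul _), integral_const_mul, integral_const_mul]
  set A := Real.sqrt X with hA
  set B := Real.sqrt Y with hB
  have hA0 : 0 ≤ A := Real.sqrt_nonneg _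
  have hB0 : 0 ≤ B := Real.sqrt_nonneg _
  have hXA : X = A ^ 2 := (Real.sq_sqrt hX0).symm
  have hYB : Y = B ^ 2 := (Real.sq_sqrt hY0).symm
  -- `√Z ≤ A + B + ε` for every `ε > 0`
  refine le_of_forall_pos_le_add fun ε hε => ?_
  set A' := A + ε / 2 with hA'
  set B' := B + ε / 2 with hB'
  have hA'0 : 0 < A' := by positivity
  have hB'0 : 0 < B' := by positivity
  have hZle : Z ≤ (A' + B') ^ 2 := by
    have h := hZt (B' / A') (div_pos hB'0 hA'0)
    have hXle : X ≤ A' ^ 2 := by rw [hXA]; gcongr; linarith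
    have hYle : Y ≤ B' ^ 2 := by rw [hYB]; gcongr; linarith
    have h1 : 0 ≤ 1 + B' / A' := by positivity
    have h2 : 0 ≤ 1 + (B' / A')⁻¹ := by positivity
    calc Z ≤ (1 + B' / A') * X + (1 + (B' / A')⁻¹) * Y := h
      _ ≤ (1 + B' / A') * A' ^ 2 + (1 + (B' / A')⁻¹) * B' ^ 2 := by gcongr
      _ = (A' + B') ^ 2 := by
          field_simp
          ring
  calc Real.sqrt Z ≤ Real.sqrt ((A' + B') ^ 2) := Real.sqrt_le_sqrt hZle
    _ = A' + B' := Real.sqrt_sq (by positivity)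
    _ = A + B + ε := by rw [hA', hB']; ring

end Elementary

/-! ### Gluing two couplings along the middle marginal (triple law) -/

section Gluing

variable {Ω₁ Ω₂ Ω₃ : Type*} [MeasurableSpace Ω₁] [MeasurableSpace Ω₂] [MeasurableSpace Ω₃]

/-- **Gluing lemma, triple form.** Two finite couplings `P` on `Ω₁ × Ω₂` and `Q` on `Ω₂ × Ω₃` with the same
middle marginal are the `(1,2)`- and `(2,3)`-marginals of one measure `R` on `Ω₂ × (Ω₁ × Ω₃)` (disintegration of
both over the middle coordinate and product of the conditional kernels; Villani 2009, Ch. 1; the construction of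
`Literature.Probability.RandomPlanarGeometry.exists_glued_coupling`, with the triple law exposed). -/
theorem exists_glued_triple [StandardBorelSpace Ω₁] [Nonempty Ω₁] [StandardBorelSpace Ω₃] [Nonempty Ω₃]
    (P : Measure (Ω₁ × Ω₂)) (Q : Measure (Ω₂ × Ω₃)) [IsFiniteMeasure P] [IsFiniteMeasure Q]
    (h : P.map Prod.snd = Q.map Prod.fst) :
    ∃ R : Measure (Ω₂ × (Ω₁ × Ω₃)),
      R.map (fun p => (p.2.1, p.1)) = P ∧ R.map (Prod.map id Prod.snd) = Q := by
  set P' : Measure (Ω₂ × Ω₁) := P.map Prod.swap with hP'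
  set μ₂ : Measure Ω₂ := Q.fst with hμ₂
  have hP'fst : P'.fst = μ₂ := by
    rw [Measure.fst, hP', Measure.map_map measurable_fst measurable_swap]
    exact h
  set κ : Kernel Ω₂ Ω₁ := P'.condKernel with hκ
  set η : Kernel Ω₂ Ω₃ := Q.condKernel with hη
  have hPd : μ₂ ⊗ₘ κ = P' := by rw [← hP'fst]; exact Measure.disintegrate P' κ
  have hQd : μ₂ ⊗ₘ η = Q := Measure.disintegrate Q η
  set R : Measure (Ω₂ × (Ω₁ × Ω₃)) := μ₂ ⊗ₘ (κ ×ₖ η) with hR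
  have hR12 : R.map (fun p => (p.2.1, p.1)) = P := by
    have e : (fun p : Ω₂ × (Ω₁ × Ω₃) => (p.2.1, p.1)) = Prod.swap ∘ Prod.map id Prod.fst := rfl
    rw [e, ← Measure.map_map measurable_swap (measurable_id.prodMap measurable_fst), hR,
      ← Measure.compProd_map measurable_fst, ← Kernel.fst_eq, Kernel.fst_prod, hPd, hP',
      Measure.map_map measurable_swap measurable_swap, Prod.swap_swap_eq, Measure.map_id]
  have hR23 : R.map (Prod.map id Prod.snd) = Q := by
    rw [hR, ← Measure.compProd_map measurable_snd, ← Kernel.snd_eq, Kernel.snd_prod, hQd]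
  exact ⟨R, hR12, hR23⟩

end Gluing

/-! ### The `L²` gluing step and the chain -/

section Chain

variable {Ω : Type*} [MeasurableSpace Ω]

/-- A measure on a product whose first marginal is a probability measure is a probability measure. -/
theorem isProbabilityMeasure_of_fst_eq {μ : Measure Ω} [IsProbabilityMeasure μ] {T : Measure (Ω × Ω)}
    (h : T.fst = μ) : IsProbabilityMeasure T :=
  ⟨by rw [← Measure.fst_univ, h]; exact measure_univ⟩

/-- **`L²` gluing step.** Couplings `P` of `(μ₁, μ₂)` and `Q` of `(μ₂, μ₃)` (probability, standard Borel) glue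
to a coupling `T` of `(μ₁, μ₃)` with `‖F∘fst − H∘snd‖_{L²(T)} ≤ ‖F∘fst − G∘snd‖_{L²(P)} + ‖G∘fst − H∘snd‖_{L²(Q)}`
for all bounded measurable `F, G, H` simultaneously. -/
theorem l2_glue_step [StandardBorelSpace Ω] [Nonempty Ω] (P Q : Measure (Ω × Ω))
    [IsProbabilityMeasure P] [IsProbabilityMeasure Q] (h : P.snd = Q.fst) :
    ∃ T : Measure (Ω × Ω), T.fst = P.fst ∧ T.snd = Q.snd ∧
      ∀ (F G H : Ω → ℝ), Measurable F → Measurable G → Measurable H →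
        (∃ B, ∀ x, |F x| ≤ B) → (∃ B, ∀ x, |G x| ≤ B) → (∃ B, ∀ x, |H x| ≤ B) →
          Real.sqrt (∫ q, (F q.1 - H q.2) ^ 2 ∂T) ≤
            Real.sqrt (∫ q, (F q.1 - G q.2) ^ 2 ∂P) + Real.sqrt (∫ q, (G q.1 - H q.2) ^ 2 ∂Q) := by
  obtain ⟨ν3, hR12, hR23⟩ := exists_glued_triple P Q h
  have hm12 : Measurable (fun p : Ω × (Ω × Ω) => (p.2.1, p.1)) := measurable_snd.fst.prodMk measurable_fst
  have hm23 : Measurable (Prod.map id Prod.snd : Ω × (Ω × Ω) → Ω × Ω) := measurable_id.prodMap measurable_snd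
  -- `ν3` is a probability measure
  haveI : IsProbabilityMeasure ν3 := by
    constructor
    have := congrArg (fun ν : Measure (Ω × Ω) => ν Set.univ) hR23
    simp only [Measure.map_apply hm23 MeasurableSet.univ, Set.preimage_univ, measure_univ] at this
    exact this
  refine ⟨ν3.snd, ?_, ?_, ?_⟩
  · rw [Measure.snd, Measure.fst, Measure.map_map measurable_fst measurable_snd, ← hR12, Measure.fst,
      Measure.map_map measurable_fst hm12]
    rfl
  · rw [Measure.snd, Measure.snd, Measure.map_map measurable_snd measurable_snd, ← hR23, Measure.snd,
      Measure.map_map measurable_snd hm23]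
    rfl
  · intro F G H hF hG hH hFb hGb hHb
    -- transport the three integrals to `ν3`
    have e13 : (∫ q, (F q.1 - H q.2) ^ 2 ∂ν3.snd) = ∫ p, (F p.2.1 - H p.2.2) ^ 2 ∂ν3 := by
      rw [Measure.snd, integral_map measurable_snd.aemeasurable]
      exact ((hF.comp measurable_fst).sub (hH.comp measurable_snd)).pow_const 2 |>.aestronglyMeasurable
    have e12 : (∫ q, (F q.1 - G q.2) ^ 2 ∂P) = ∫ p, (F p.2.1 - G p.1) ^ 2 ∂ν3 := by
      rw [← hR12, integral_map hm12.aemeasurable]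
      exact ((hF.comp measurable_fst).sub (hG.comp measurable_snd)).pow_const 2 |>.aestronglyMeasurable
    have e23 : (∫ q, (G q.1 - H q.2) ^ 2 ∂Q) = ∫ p, (G p.1 - H p.2.2) ^ 2 ∂ν3 := by
      rw [← hR23, integral_map hm23.aemeasurable]
      · rfl
      exact ((hG.comp measurable_fst).sub (hH.comp measurable_snd)).pow_const 2 |>.aestronglyMeasurable
    rw [e13, e12, e23]
    obtain ⟨BF, hBF⟩ := hFb
    obtain ⟨BG, hBG⟩ := hGb
    obtain ⟨BH, hBH⟩ := hHb
    exact sqrt_integral_sq_sub_le ν3 (a := fun p => F p.2.1) (b := fun p => G p.1) (c := fun p => H p.2.2)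
      (hF.comp measurable_snd.fst) (hG.comp measurable_fst) (hH.comp measurable_snd.snd)
      ⟨BF, fun p => hBF _⟩ ⟨BG, fun p => hBG _⟩ ⟨BH, fun p => hBH _⟩

/-- **`L²` gluing chain.** For couplings `π 0, π 1, …` of a probability measure `μ` with itself (standard Borel)
and every length `L` there is one coupling `T` of `μ` with `μ` under which, for EVERY family of bounded measurable
observables `F 0, …, F L` at once,
`‖F 0 ∘ fst − F L ∘ snd‖_{L²(T)} ≤ Σ_{k<L} ‖F k ∘ fst − F (k+1) ∘ snd‖_{L²(π k)}`. -/
theorem l2_glue_chain [StandardBorelSpace Ω] [Nonempty Ω] (μ : Measure Ω) [IsProbabilityMeasure μ]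
    (π : ℕ → Measure (Ω × Ω)) (hfst : ∀ k, (π k).fst = μ) (hsnd : ∀ k, (π k).snd = μ) (L : ℕ) :
    ∃ T : Measure (Ω × Ω), T.fst = μ ∧ T.snd = μ ∧
      ∀ (F : ℕ → Ω → ℝ), (∀ k, Measurable (F k)) → (∀ k, ∃ B, ∀ x, |F k x| ≤ B) →
        Real.sqrt (∫ q, (F 0 q.1 - F L q.2) ^ 2 ∂T) ≤
          ∑ k ∈ Finset.range L, Real.sqrt (∫ q, (F k q.1 - F (k + 1) q.2) ^ 2 ∂(π k)) := by
  induction L with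
  | zero =>
    have hdiag : Measurable (fun x : Ω => (x, x)) := measurable_id.prodMk measurable_id
    refine ⟨μ.map (fun x => (x, x)), ?_, ?_, ?_⟩
    · rw [Measure.fst, Measure.map_map measurable_fst hdiag]
      exact Measure.map_id
    · rw [Measure.snd, Measure.map_map measurable_snd hdiag]
      exact Measure.map_id
    · intro F hF hFb
      rw [Finset.sum_range_zero, integral_map hdiag.aemeasurable]
      · simp
      · exact (((hF 0).comp measurable_fst).sub ((hF 0).comp measurable_snd)).pow_const 2
          |>.aestronglyMeasurable
  | succ L ih =>
    obtain ⟨TL, hTL1, hTL2, hTL⟩ := ih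
    haveI : IsProbabilityMeasure TL := isProbabilityMeasure_of_fst_eq hTL1
    haveI : IsProbabilityMeasure (π L) := isProbabilityMeasure_of_fst_eq (hfst L)
    obtain ⟨T, hT1, hT2, hT⟩ := l2_glue_step TL (π L) (by rw [hTL2, hfst])
    refine ⟨T, by rw [hT1, hTL1], by rw [hT2, hsnd], ?_⟩
    intro F hF hFb
    calc Real.sqrt (∫ q, (F 0 q.1 - F (L + 1) q.2) ^ 2 ∂T)
        ≤ Real.sqrt (∫ q, (F 0 q.1 - F L q.2) ^ 2 ∂TL) +
            Real.sqrt (∫ q, (F L q.1 - F (L + 1) q.2) ^ 2 ∂(π L)) :=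
          hT (F 0) (F L) (F (L + 1)) (hF 0) (hF L) (hF (L + 1)) (hFb 0) (hFb L) (hFb (L + 1))
      _ ≤ (∑ k ∈ Finset.range L, Real.sqrt (∫ q, (F k q.1 - F (k + 1) q.2) ^ 2 ∂(π k))) +
            Real.sqrt (∫ q, (F L q.1 - F (L + 1) q.2) ^ 2 ∂(π L)) := by
          gcongr; exact hTL F hF hFb
      _ = ∑ k ∈ Finset.range (L + 1), Real.sqrt (∫ q, (F k q.1 - F (k + 1) q.2) ^ 2 ∂(π k)) := by
          rw [Finset.sum_range_succ]

end Chain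

/-! ### Registered specialisation to Ising configurations on `ℤ³` -/

open Literature.Probability.LatticeModels

/-- **Registered sub-goal `stub_l2GlueChain`** (tool of `stub_rateBootstrap`): the `L²` gluing chain for couplings
of a probability measure on `SpinConfig (Site 3)` with itself. -/
theorem stub_l2GlueChain :
    ∀ (μ : Measure (SpinConfig (Site 3))) [IsProbabilityMeasure μ]
      (π : ℕ → Measure (SpinConfig (Site 3) × SpinConfig (Site 3))),
      (∀ k, (π k).fst = μ) → (∀ k, (π k).snd = μ) → ∀ L : ℕ,
        ∃ T : Measure (SpinConfig (Site 3) × SpinConfig (Site 3)), T.fst = μ ∧ T.snd = μ ∧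
          ∀ (F : ℕ → SpinConfig (Site 3) → ℝ), (∀ k, Measurable (F k)) → (∀ k, ∃ B, ∀ x, |F k x| ≤ B) →
            Real.sqrt (∫ q, (F 0 q.1 - F L q.2) ^ 2 ∂T) ≤
              ∑ k ∈ Finset.range L, Real.sqrt (∫ q, (F k q.1 - F (k + 1) q.2) ^ 2 ∂(π k)) :=
  fun μ _ π hfst hsnd L => l2_glue_chain μ π hfst hsnd L

end Summit.CriticalPhenomena.Ising3DConformalLimit.Cruxes.RotationJoining.RateSplitting

end
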